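import Summits.QuantumFields.YangMills.Theorems.BalabanUVNodesN10LocECouplingLipschitz

/-!
# BalabanUVNodes ∕ N10 ([B13], NODE A) → N22 (NE9): THE GENERATOR's LAST-COUPLING SECTOR ROWS (`hholS`, `hbdS`) FROM TERM-LEVEL COUPLING LETTERS
# — [KP86] holomorphy in the COMPLEX COUPLING + the Lipschitz storey for (2.13) of module 109A, summed from the terms by Lemma 3 (module 109B)

Track A of `YM-PLAN.md` (cell `pub-ymgap`, D-0062), seat `pub-ymgap-dag-n10-c` g20, DAG edge **N10 → N22**, module 109.  THEOREMS ONLY (0 `def`, 0 `sorry`, standard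
axioms); `--supports stmt-QuantumFields-27364 --as helper`; COUNT-NEUTRAL.  Answers the N22 lane's trigger (t31) «a producer of the last-coupling rows for term data»
(dag-n22-c g19 ■): the N22 bill at def-W1's term data `(𝔇 K).Gn` (junctions of record J76 ∕ J77) displays, besides NODE A's located (2.26) records, the LAST-COUPLING
rows of `z ↦ ((𝔇 K).Gn k).E z old φ X` — sector holomorphy `hholS` on an open `O K ⊆ ℂ` and the CENTRED quadratic bound `hbdS : ‖E(z) − V‖ ≤ B_q·e^{−κ_E d(X)}·s²` on
the discs `|z − s| ≤ c_S·s`, `s ∈ ]0, γ]` (ROAD 2; ROAD 1's first-order row `hGt` follows by the N22 lane's `genT1last_of_lastSectorHolo`).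
WHAT (the module-101 ∕ 102 pattern with the Banach parameter := THE COMPLEX COUPLING, older terms FIXED).  The one-step tools are module 109A
`…N10LocECouplingLipschitz`: ★
`differentiableOn_and_norm_locE_of_couplingReading` (S25's [KP86] face at `P := ℂ`, any open `U := O`: activities holomorphic on `O` under one (2.38)-shape majorant ⟹
(2.13) holomorphic on `O` with the (2.41) envelope); ★ `norm_sub_le_of_diffOn_ball` (Schwarz: holomorphic `f` bounded by `M_f` on `ball 0 R₁`, `1 < R₁` ⟹
`‖f 1 − f 0‖ ≤ 2M_f∕R₁`); ★★ `norm_locE_sub_locE_le_of_deviation` — THE LIPSCHITZ STOREY: `H₀, H₁` in the `A`-polydisc with `‖H₁ − H₀‖ ≤ q·A·e^{−R₃₈ d}` (`q ≥ 0`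
arbitrary), numerals at `2A` ⟹ `‖locE H₁ X − locE H₀ X‖ ≤ 2·M_b(2A)·e^{−r₁ d(X)}·q` (affine pencil in the `2A`-polydisc on `|λ| < 1∕q` + Schwarz when `q < 1`; crude bound
when `q ≥ 1`; `locE_congr` when `q = 0`).  §2 (d = 4, every torus and step) `norm_le_238_of_termwise226_scaled` (Lemma 3 with a scalar factor) and ★★★
`lastCouplingSectors_ofTerms_of_termSectors`: from the TERM-LEVEL COUPLING LETTERS on the class `Adm K k` and table `spX K k X` — (TS-holo) `z ↦ T K k Z s z old φ`
holomorphic on `O K`; (TS-226) `‖T … z …‖ ≤ weight·e^{a₅|Z|}` on `O K` ([II] (2.26) read at complex coupling); a z-free centre `T₀` with (TS-226₀) the same weight and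
(TS-centred) `‖T … z … − T₀ …‖ ≤ C_q·‖z‖²·(weight·e^{a₅|Z|})` ([I] (2.13) p. 268 «the first-order term vanishes»; this lane's centred (2.15) engines `B13Term214Centred` ∕
`B13Bound226Centred` produce this shape at the torus level) + `Lemma3Numerics` + the numerals at `2C₃ε₁` ⟹ (hholS) ∧ ((2.41) on `O K`) ∧ (hbdS) with the EXPLICIT
vertex `V := (GenTower.ofTerms L (centre terms) k).E 0 old φ X`, `B_q := 2·(e·9·64·K₀(64,8)²·(2C₃ε₁))·C_q·(1+c_S)²`, `κ_E := r₁`.  §3 ★★★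
`lastCouplingSectors_termData_of_termSectors` — §2 AT def-W1's TERM DATA (`(𝔇 K).Gn = GenTower.ofTerms L (𝔇 K).TF`, `rfl`): the N22 binders `hholS hbdS` of ROAD 2 for
`((𝔇 K).Gn k).E` (consumer's `Adm K k old := old ∈ AdmHist (sp K) E₀ r₁ k ∧ old 0 = 0`, `spX K k := sp K (k+1)`).
HONEST FRAMING (binding).  Kernel COMPOSITION of tree theorems ([KP86] `B13LocEAnalytic` + (2.41) via S25; Lemma 3 via module 102 §1; Mathlib's Schwarz lemma) with
def-W1's generators BY TYPING; the per-term coupling letters, the class, the tables, the open sets and every numeral are DISPLAYED HYPOTHESES — holomorphy of a (2.14)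
term in the COMPLEX coupling with (2.26) on a sector is NOT print's (2.3) (characteristic functions at a real coupling) read literally and is asserted nowhere here; NO
estimate of Bałaban's is proved; nothing of the record is constructed.  N10 ∕ N22 NOT discharged (28∕28 · 6∕27 UNCHANGED); K1⁹ ∕ K3⁸ NOT closed; one finite 𝕋⁴
programme at fixed ε — nothing continuum ∕ ℝ⁴ ∕ OS ∕ mass-gap ∕ Clay.  References (TYPES only): [II] CMP 116 (1988) (2.13)–(2.15) pp. 14–15, (2.26) p. 17, (2.38) p. 20,
(2.41) p. 21; [I] CMP 109 (1987) p. 263, (2.13) p. 268; [KP86] CMP 103 (1986) Theorem p. 492.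
-/


noncomputable section

open Set Metric
open scoped BigOperators

namespace YMDAG.N10

open Literature.MathematicalPhysics.QuantumFieldTheory.Balaban1983to89
open Literature.MathematicalPhysics.QuantumFieldTheory.Balaban1983to89.T4Continuum (T4Family)
open Literature.MathematicalPhysics.QuantumFieldTheory.Balaban1983to89.B12TreeDecay (K₀ kappa₀)
open Literature.MathematicalPhysics.QuantumFieldTheory.Balaban1983to89.B13Resummation (locE locE_congr)
open Literature.MathematicalPhysics.QuantumFieldTheory.Balaban1983to89.TreeLengthTorusGeometry (tgeometry)
open Literature.MathematicalPhysics.QuantumFieldTheory.Balaban1983to89.B13Lemma3TorusTerms (terms weight weight_nonneg)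
open Literature.MathematicalPhysics.QuantumFieldTheory.Balaban1983to89.B13Lemma3TorusSocket (Lemma3Numerics)
open Literature.MathematicalPhysics.QuantumFieldTheory.Balaban1983to89.Node00.Sect2 (domSys domCount CPair)
open Literature.MathematicalPhysics.QuantumFieldTheory.Balaban1983to89.Node00.W1
open Summit.QuantumFields.BalabanUV.T4Continuum.NE1p.DressedOutputAnalyticFaces (analytic_and_bounded_locE_param_of_geometry)

/-! ## §2 ★★★ The generator's last-coupling sector rows from TERM-level coupling letters (d = 4, every torus and step; term-indexed generators) -/
section OfTerms

variable (F : T4Family) {M : ℕ} [NeZero M] (L : ℕ) [NeZero L] {𝔸 : Type} (T : (K : ℕ) → GenTermFun (F.P K) 𝔸 M L)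
  (T₀ : (K k : ℕ) → (domSys (F.P K) M (k + 1)).Dom → TermLabel (F.P K) M k L → OlderTerms (F.P K) 𝔸 M k → CPair (F.P K) 𝔸 → ℂ)
  (spX : (K k : ℕ) → (domSys (F.P K) M (k + 1)).Dom → Set (CPair (F.P K) 𝔸)) (Adm : (K k : ℕ) → OlderTerms (F.P K) 𝔸 M k → Prop)
  (O : ℕ → Set ℂ)

open Classical in
/-- (Lemma 3 with a scalar factor) (2.26) per term SCALED by `q φ ≥ 0` ⟹ (2.38) scaled by `q φ` — module 102 §1 applied to the family divided by `q φ` (the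
resummation is positively homogeneous; `q φ = 0` forces every term, hence the dominated activity, to vanish). [folklore] -/
theorem norm_le_238_of_termwise226_scaled (K : ℕ) {k : ℕ} {Φ : Type} (spT : (domSys (F.P K) M (k + 1)).Dom → Set Φ)
    (H : (domSys (F.P K) M (k + 1)).Dom → Φ → ℂ) (Tm : (domSys (F.P K) M (k + 1)).Dom → TermLabel (F.P K) M k L → Φ → ℂ) (q : Φ → ℝ) (hq : ∀ φ, 0 ≤ q φ)
    (c : B13.Consts) (hL : 8 ≤ c.L) (hLc : c.L = L) {a a₂ a₂' a₅ Aabs : ℝ} (hN : Lemma3Numerics c M ((c.L : ℝ) / 2) a a₂ a₂' a₅ Aabs)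
    (hdom : ∀ (Z : (domSys (F.P K) M (k + 1)).Dom) (φ : Φ), φ ∈ spT Z → ‖H Z φ‖ ≤ ∑ s ∈ terms L M Z, ‖Tm Z s φ‖)
    (h226 : ∀ (Z : (domSys (F.P K) M (k + 1)).Dom) (φ : Φ), φ ∈ spT Z → ∀ s ∈ terms L M Z,
      ‖Tm Z s φ‖ ≤ q φ * (weight L M c Z a s * Real.exp (a₅ * ((Z.1).card : ℝ)))) :
    ∀ (Z : (domSys (F.P K) M (k + 1)).Dom) (φ : Φ), φ ∈ spT Z →
      ‖H Z φ‖ ≤ q φ * (c.C3act * c.ε₁ * Real.exp (-((1 - 8 * c.δ) * ((c.L : ℝ) / 2) * c.κ * (domSys (F.P K) M (k + 1)).dj Z))) := by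
  have hw0 : ∀ (Z : (domSys (F.P K) M (k + 1)).Dom) (s : TermLabel (F.P K) M k L), 0 ≤ weight L M c Z a s :=
    fun Z s => weight_nonneg (L := L) (M := M) c Z a (mul_nonneg hN.hα₆.le hN.hε₀) s
  -- module 102 §1 on the family scaled by `(q φ)⁻¹` (real scalar action)
  have hmain := norm_le_238_of_termwise226 F K L (k := k) (Φ := Φ) spT (fun Z φ => (q φ)⁻¹ • H Z φ) (fun Z s φ => (q φ)⁻¹ • Tm Z s φ) c hL hLc hN
    (fun Z φ hφ => by
      rw [norm_smul]
      calc ‖(q φ)⁻¹‖ * ‖H Z φ‖ ≤ ‖(q φ)⁻¹‖ * ∑ s ∈ terms L M Z, ‖Tm Z s φ‖ :=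
            mul_le_mul_of_nonneg_left (hdom Z φ hφ) (norm_nonneg _)
        _ = ∑ s ∈ terms L M Z, ‖(q φ)⁻¹ • Tm Z s φ‖ := by rw [Finset.mul_sum]; simp_rw [norm_smul])
    (fun Z φ hφ s hs => by
      rw [norm_smul, Real.norm_of_nonneg (inv_nonneg.2 (hq φ))]
      by_cases h0 : q φ = 0
      · rw [h0, inv_zero, zero_mul]
        exact mul_nonneg (hw0 Z s) (Real.exp_nonneg _)
      · have hq' : 0 < q φ := lt_of_le_of_ne (hq φ) (Ne.symm h0)
        rw [inv_mul_le_iff₀ hq']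
        exact h226 Z φ hφ s hs)
  intro Z φ hφ
  by_cases h0 : q φ = 0
  · -- every term vanishes, hence the dominated activity
    have hT0 : ∀ s ∈ terms L M Z, ‖Tm Z s φ‖ = 0 := fun s hs =>
      le_antisymm ((h226 Z φ hφ s hs).trans (by rw [h0, zero_mul])) (norm_nonneg _)
    have hH : ‖H Z φ‖ ≤ 0 := (hdom Z φ hφ).trans (le_of_eq (Finset.sum_eq_zero hT0))
    rw [h0, zero_mul]
    exact hH
  · have hq' : 0 < q φ := lt_of_le_of_ne (hq φ) (Ne.symm h0)
    have h := hmain Z φ hφ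
    rw [norm_smul, Real.norm_of_nonneg (inv_nonneg.2 (hq φ)), inv_mul_le_iff₀ hq'] at h
    exact h

open Classical in
/-- ★★★ **THE GENERATOR's LAST-COUPLING SECTOR ROWS (`hholS`, the (2.41) bound on `O`, `hbdS`) FROM TERM-LEVEL COUPLING LETTERS** for the term-indexed generators
`GenTower.ofTerms L (T K)`.  On the class `Adm K k` and the table `spX K k X` (polymers `Z ⊂ X`, labels `s ∈ terms L M Z`): (TS-holo) `z ↦ T K k Z s z old φ` complex
differentiable on the open `O K`; (TS-226) `‖T K k Z s z old φ‖ ≤ weight L M c Z a s·e^{a₅|Z|}` on `O K`; a z-free centre `T₀` with (TS-226₀) the same weight and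
(TS-centred) `‖T K k Z s z old φ − T₀ K k Z s old φ‖ ≤ C_q·‖z‖²·(weight·e^{a₅|Z|})` on `O K`; `Lemma3Numerics c M (½L) …`, `8 ≤ L = c.L`, `0 ≤ C₃ε₁`, `0 ≤ r₁`, the located
clauses `r₁ + 2·(64·log 162) + 2 ≤ (1−8δ)·½L·κ` and `2C₃ε₁·e^{5r₁+1}·K₀(64,8)·9·64 ≤ 1`; sector discs `closedBall s (c_S·s) ⊆ O K` for `s ∈ ]0,γ]` ⟹
**(hholS)** `DifferentiableOn ℂ (z ↦ (GenTower.ofTerms L (T K) k).E z old φ X) (O K)`; **(2.41)** `‖…E z old φ X‖ ≤ e·9·64·K₀(64,8)²·C₃ε₁·e^{−r₁ d_{k+1}(X)}` on `O K`;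
**(hbdS)** `‖…E z old φ X − V K k old φ X‖ ≤ (2·(e·9·64·K₀(64,8)²·(2C₃ε₁))·C_q·(1+c_S)²)·e^{−r₁ d_{k+1}(X)}·s²` for `z ∈ closedBall s (c_S·s)`, with the EXPLICIT vertex
`V K k old φ X := (GenTower.ofTerms L (fun k Z s _ old φ ↦ T₀ K k Z s old φ) k).E 0 old φ X`.  §1 fed by module 102 §1 (Lemma 3) and its scaled form. [folklore] -/
theorem lastCouplingSectors_ofTerms_of_termSectors (c : B13.Consts) (hL : 8 ≤ c.L) (hLc : c.L = L) {ar a₂ a₂' a₅ Aabs : ℝ}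
    (hN : Lemma3Numerics c M ((c.L : ℝ) / 2) ar a₂ a₂' a₅ Aabs) (hA0 : 0 ≤ c.C3act * c.ε₁) {γ r₁ Cq cS : ℝ} (hr₁ : 0 ≤ r₁) (hCq : 0 ≤ Cq)
    (hrate : r₁ + 2 * (64 * Real.log 162) + 2 ≤ (1 - 8 * c.δ) * ((c.L : ℝ) / 2) * c.κ)
    (hsmall2 : 2 * (c.C3act * c.ε₁) * Real.exp (5 * r₁ + 1) * K₀ 64 8 * 9 * 64 ≤ 1)
    (hO : ∀ K, IsOpen (O K)) (hballS : ∀ K, ∀ s ∈ Ioc (0 : ℝ) γ, closedBall (s : ℂ) (cS * s) ⊆ O K)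
    (hTh : ∀ (K k : ℕ) (old : OlderTerms (F.P K) 𝔸 M k), Adm K k old → ∀ (X : (domSys (F.P K) M (k + 1)).Dom), ∀ φ ∈ spX K k X,
      ∀ Z : (domSys (F.P K) M (k + 1)).Dom, Subtype.val Z ⊆ Subtype.val X → ∀ s ∈ terms L M Z, DifferentiableOn ℂ (fun z => T K k Z s z old φ) (O K))
    (hT226 : ∀ (K k : ℕ) (old : OlderTerms (F.P K) 𝔸 M k), Adm K k old → ∀ (X : (domSys (F.P K) M (k + 1)).Dom), ∀ φ ∈ spX K k X,
      ∀ Z : (domSys (F.P K) M (k + 1)).Dom, Subtype.val Z ⊆ Subtype.val X → ∀ s ∈ terms L M Z, ∀ z ∈ O K,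
        ‖T K k Z s z old φ‖ ≤ weight L M c Z ar s * Real.exp (a₅ * ((Z.1).card : ℝ)))
    (hT₀ : ∀ (K k : ℕ) (old : OlderTerms (F.P K) 𝔸 M k), Adm K k old → ∀ (X : (domSys (F.P K) M (k + 1)).Dom), ∀ φ ∈ spX K k X,
      ∀ Z : (domSys (F.P K) M (k + 1)).Dom, Subtype.val Z ⊆ Subtype.val X → ∀ s ∈ terms L M Z,
        ‖T₀ K k Z s old φ‖ ≤ weight L M c Z ar s * Real.exp (a₅ * ((Z.1).card : ℝ)))
    (hTq : ∀ (K k : ℕ) (old : OlderTerms (F.P K) 𝔸 M k), Adm K k old → ∀ (X : (domSys (F.P K) M (k + 1)).Dom), ∀ φ ∈ spX K k X,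
      ∀ Z : (domSys (F.P K) M (k + 1)).Dom, Subtype.val Z ⊆ Subtype.val X → ∀ s ∈ terms L M Z, ∀ z ∈ O K,
        ‖T K k Z s z old φ - T₀ K k Z s old φ‖ ≤ Cq * ‖z‖ ^ 2 * (weight L M c Z ar s * Real.exp (a₅ * ((Z.1).card : ℝ)))) :
    (∀ (K k : ℕ) (old : OlderTerms (F.P K) 𝔸 M k), Adm K k old → ∀ (X : (domSys (F.P K) M (k + 1)).Dom), ∀ φ ∈ spX K k X,
      DifferentiableOn ℂ (fun z => (GenTower.ofTerms L (T K) k).E z old φ X) (O K)) ∧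
    (∀ (K k : ℕ) (old : OlderTerms (F.P K) 𝔸 M k), Adm K k old → ∀ (X : (domSys (F.P K) M (k + 1)).Dom), ∀ φ ∈ spX K k X, ∀ z ∈ O K,
      ‖(GenTower.ofTerms L (T K) k).E z old φ X‖ ≤
        Real.exp 1 * 9 * 64 * K₀ 64 8 ^ 2 * (c.C3act * c.ε₁) * Real.exp (-(r₁ * (domSys (F.P K) M (k + 1)).dj X))) ∧
    (∀ (K k : ℕ) (old : OlderTerms (F.P K) 𝔸 M k), Adm K k old → ∀ (X : (domSys (F.P K) M (k + 1)).Dom), ∀ φ ∈ spX K k X,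
      ∀ s ∈ Ioc (0 : ℝ) γ, ∀ z ∈ closedBall (s : ℂ) (cS * s),
        ‖(GenTower.ofTerms L (T K) k).E z old φ X -
            (GenTower.ofTerms L (fun k Z s (_ : ℂ) old φ => T₀ K k Z s old φ) k).E 0 old φ X‖ ≤
          2 * (Real.exp 1 * 9 * 64 * K₀ 64 8 ^ 2 * (2 * (c.C3act * c.ε₁))) * Cq * (1 + cS) ^ 2 *
            Real.exp (-(r₁ * (domSys (F.P K) M (k + 1)).dj X)) * s ^ 2) := by
  -- the numerals of `tgeometry 4 ·`
  have hκ : kappa₀ (4 * 2 ^ 4) (2 * 4) = 64 * Real.log 162 := TreeLengthCubeSystem.kappa₀_four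
  have e64 : (4 : ℝ) * 2 ^ 4 = 64 := by norm_num
  have e9 : (2 : ℝ) * ((4 : ℕ) : ℝ) + 1 = 9 := by norm_num
  have hrate' : ∀ K : ℕ, r₁ + 2 * kappa₀ (4 * 2 ^ (F.P K).d) (2 * (F.P K).d) + 2 ≤ (1 - 8 * c.δ) * ((c.L : ℝ) / 2) * c.κ := fun K => by
    rw [F.P_d K, hκ]; exact hrate
  have hsmall2' : ∀ K : ℕ, 2 * (c.C3act * c.ε₁) * Real.exp (5 * r₁ + 1) * K₀ (4 * 2 ^ (F.P K).d) (2 * (F.P K).d) * (2 * ((F.P K).d : ℝ) + 1) *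
      (4 * 2 ^ (F.P K).d) ≤ 1 := fun K => by
    rw [F.P_d K, e64, e9]
    calc 2 * (c.C3act * c.ε₁) * Real.exp (5 * r₁ + 1) * K₀ 64 (2 * 4) * 9 * 64
        = 2 * (c.C3act * c.ε₁) * Real.exp (5 * r₁ + 1) * K₀ 64 8 * 9 * 64 := by norm_num
      _ ≤ 1 := hsmall2
  have hsmall' : ∀ K : ℕ, (c.C3act * c.ε₁) * Real.exp (5 * r₁ + 1) * K₀ (4 * 2 ^ (F.P K).d) (2 * (F.P K).d) * (2 * ((F.P K).d : ℝ) + 1) *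
      (4 * 2 ^ (F.P K).d) ≤ 1 := fun K => by
    have h0 : 0 ≤ (c.C3act * c.ε₁) * Real.exp (5 * r₁ + 1) * K₀ (4 * 2 ^ (F.P K).d) (2 * (F.P K).d) * (2 * ((F.P K).d : ℝ) + 1) *
        (4 * 2 ^ (F.P K).d) := by
      have := (B12TreeDecay.K₀_pos (4 * 2 ^ (F.P K).d) (2 * (F.P K).d)).le; positivity
    have := hsmall2' K
    linarith
  have eM : ∀ K : ℕ, Real.exp 1 * (2 * ((F.P K).d : ℝ) + 1) * (4 * 2 ^ (F.P K).d) * K₀ (4 * 2 ^ (F.P K).d) (2 * (F.P K).d) ^ 2 =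
      Real.exp 1 * 9 * 64 * K₀ 64 8 ^ 2 := fun K => by
    rw [F.P_d K, e64, e9]
  -- the (2.38) majorant of the activities, the centre activities and the deviation (Lemma 3, module 102 §1 and its scaled form)
  set R₃₈ : ℝ := (1 - 8 * c.δ) * ((c.L : ℝ) / 2) * c.κ with hR₃₈
  have hH : ∀ (K k : ℕ) (old : OlderTerms (F.P K) 𝔸 M k), Adm K k old → ∀ (X : (domSys (F.P K) M (k + 1)).Dom), ∀ φ ∈ spX K k X,
      ∀ Z : (domSys (F.P K) M (k + 1)).Dom, Subtype.val Z ⊆ Subtype.val X → ∀ z ∈ O K,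
        ‖(GenTower.ofTerms L (T K) k).H z old φ Z‖ ≤ c.C3act * c.ε₁ * Real.exp (-(R₃₈ * (domSys (F.P K) M (k + 1)).dj Z)) := by
    intro K k old hold X φ hφ Z hZ z hz
    have h := norm_le_238_of_termwise226 F K L (k := k) (Φ := ℂ) (fun Z => {z | Subtype.val Z ⊆ Subtype.val X ∧ z ∈ O K})
      (fun Z z => (GenTower.ofTerms L (T K) k).H z old φ Z) (fun Z s z => T K k Z s z old φ) c hL hLc hN
      (fun Z z _ => by rw [GenTower.ofTerms_apply, ofTerms_H]; exact norm_sum_le _ _)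
      (fun Z z hz' s hs => hT226 K k old hold X φ hφ Z hz'.1 s hs z hz'.2) Z z ⟨hZ, hz⟩
    simpa [hR₃₈, mul_assoc] using h
  have hH₀ : ∀ (K k : ℕ) (old : OlderTerms (F.P K) 𝔸 M k), Adm K k old → ∀ (X : (domSys (F.P K) M (k + 1)).Dom), ∀ φ ∈ spX K k X,
      ∀ Z : (domSys (F.P K) M (k + 1)).Dom, Subtype.val Z ⊆ Subtype.val X →
        ‖(GenTower.ofTerms L (fun k Z s (_ : ℂ) old φ => T₀ K k Z s old φ) k).H 0 old φ Z‖ ≤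
          c.C3act * c.ε₁ * Real.exp (-(R₃₈ * (domSys (F.P K) M (k + 1)).dj Z)) := by
    intro K k old hold X φ hφ Z hZ
    have h := norm_le_238_of_termwise226 F K L (k := k) (Φ := Unit) (fun Z => {u | Subtype.val Z ⊆ Subtype.val X})
      (fun Z _ => (GenTower.ofTerms L (fun k Z s (_ : ℂ) old φ => T₀ K k Z s old φ) k).H 0 old φ Z) (fun Z s _ => T₀ K k Z s old φ) c hL hLc hN
      (fun Z u _ => by rw [GenTower.ofTerms_apply, ofTerms_H]; exact norm_sum_le _ _)
      (fun Z u hu s hs => hT₀ K k old hold X φ hφ Z hu s hs) Z () hZ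
    simpa [hR₃₈, mul_assoc] using h
  have hdev : ∀ (K k : ℕ) (old : OlderTerms (F.P K) 𝔸 M k), Adm K k old → ∀ (X : (domSys (F.P K) M (k + 1)).Dom), ∀ φ ∈ spX K k X,
      ∀ Z : (domSys (F.P K) M (k + 1)).Dom, Subtype.val Z ⊆ Subtype.val X → ∀ z ∈ O K,
        ‖(GenTower.ofTerms L (T K) k).H z old φ Z - (GenTower.ofTerms L (fun k Z s (_ : ℂ) old φ => T₀ K k Z s old φ) k).H 0 old φ Z‖ ≤
          (Cq * ‖z‖ ^ 2) * (c.C3act * c.ε₁ * Real.exp (-(R₃₈ * (domSys (F.P K) M (k + 1)).dj Z))) := by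
    intro K k old hold X φ hφ Z hZ z hz
    have h := norm_le_238_of_termwise226_scaled F L K (k := k) (Φ := ℂ) (fun Z => {z | Subtype.val Z ⊆ Subtype.val X ∧ z ∈ O K})
      (fun Z z => (GenTower.ofTerms L (T K) k).H z old φ Z - (GenTower.ofTerms L (fun k Z s (_ : ℂ) old φ => T₀ K k Z s old φ) k).H 0 old φ Z)
      (fun Z s z => T K k Z s z old φ - T₀ K k Z s old φ) (fun z => Cq * ‖z‖ ^ 2) (fun z => by positivity) c hL hLc hN
      (fun Z z _ => by
        rw [GenTower.ofTerms_apply, ofTerms_H, GenTower.ofTerms_apply, ofTerms_H, ← Finset.sum_sub_distrib]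
        exact norm_sum_le _ _)
      (fun Z z hz' s hs => hTq K k old hold X φ hφ Z hz'.1 s hs z hz'.2) Z z ⟨hZ, hz⟩
    simpa [hR₃₈, mul_assoc] using h
  refine ⟨fun K k old hold X φ hφ => ?_, fun K k old hold X φ hφ z hz => ?_, fun K k old hold X φ hφ s hs z hz => ?_⟩
  · -- (hholS): §1 at the activities read in the coupling
    have h := (differentiableOn_and_norm_locE_of_couplingReading (P := F.P K) (M := M) (k := k) X (hO K)
      (h := fun Z z => (GenTower.ofTerms L (T K) k).H z old φ Z) hA0 hr₁ (hrate' K) (hsmall' K)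
      (fun Z hZ => by
        show DifferentiableOn ℂ (fun z => (GenTower.ofTerms L (T K) k).H z old φ Z) (O K)
        simp_rw [GenTower.ofTerms_apply, ofTerms_H]
        exact DifferentiableOn.fun_sum fun s hs => hTh K k old hold X φ hφ Z hZ s hs)
      (fun Z hZ z hz => hH K k old hold X φ hφ Z hZ z hz)).1
    refine h.congr fun z _ => ?_
    exact E_eq_locE_of_activityReading _ X fun Z _ => rfl
  · -- (2.41) on `O K`
    have h := (differentiableOn_and_norm_locE_of_couplingReading (P := F.P K) (M := M) (k := k) X (hO K)
      (h := fun Z z => (GenTower.ofTerms L (T K) k).H z old φ Z) hA0 hr₁ (hrate' K) (hsmall' K)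
      (fun Z hZ => by
        show DifferentiableOn ℂ (fun z => (GenTower.ofTerms L (T K) k).H z old φ Z) (O K)
        simp_rw [GenTower.ofTerms_apply, ofTerms_H]
        exact DifferentiableOn.fun_sum fun s hs => hTh K k old hold X φ hφ Z hZ s hs)
      (fun Z hZ z hz => hH K k old hold X φ hφ Z hZ z hz)).2 z hz
    rw [E_eq_locE_of_activityReading _ X fun Z _ => rfl, ← eM K]
    exact h
  · -- (hbdS): the Lipschitz storey at `q := Cq·‖z‖²`, then `‖z‖ ≤ (1 + cS)·s` on the disc
    have hzO : z ∈ O K := hballS K s hs hz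
    have hzs : ‖z‖ ≤ (1 + cS) * s := by
      have h1 : ‖z - (s : ℂ)‖ ≤ cS * s := by rw [← dist_eq_norm]; exact mem_closedBall.1 hz
      have h2 : ‖(s : ℂ)‖ = s := by rw [Complex.norm_real, Real.norm_of_nonneg hs.1.le]
      calc ‖z‖ = ‖(z - (s : ℂ)) + (s : ℂ)‖ := by rw [sub_add_cancel]
        _ ≤ ‖z - (s : ℂ)‖ + ‖(s : ℂ)‖ := norm_add_le _ _
        _ ≤ cS * s + s := add_le_add h1 h2.le
        _ = (1 + cS) * s := by ring
    have hq0 : 0 ≤ Cq * ‖z‖ ^ 2 := by positivity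
    have h := norm_locE_sub_locE_le_of_deviation (P := F.P K) (M := M) (k := k) X
      (H₀ := fun Z => (GenTower.ofTerms L (fun k Z s (_ : ℂ) old φ => T₀ K k Z s old φ) k).H 0 old φ Z)
      (H₁ := fun Z => (GenTower.ofTerms L (T K) k).H z old φ Z) hA0 hr₁ hq0 (hrate' K) (hsmall2' K)
      (fun Z hZ => hH₀ K k old hold X φ hφ Z hZ) (fun Z hZ => hH K k old hold X φ hφ Z hZ z hzO)
      (fun Z hZ => hdev K k old hold X φ hφ Z hZ z hzO)
    rw [← E_eq_locE_of_activityReading _ X fun Z _ => rfl, ← E_eq_locE_of_activityReading _ X fun Z _ => rfl, eM K] at h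
    have hz2 : ‖z‖ ^ 2 ≤ (1 + cS) ^ 2 * s ^ 2 := by
      rw [← mul_pow]; exact pow_le_pow_left₀ (norm_nonneg _) hzs 2
    have hK : 0 ≤ Real.exp 1 * 9 * 64 * K₀ 64 8 ^ 2 * (2 * (c.C3act * c.ε₁)) * Real.exp (-(r₁ * (domSys (F.P K) M (k + 1)).dj X)) := by
      have := (B12TreeDecay.K₀_pos 64 8).le; positivity
    calc ‖(GenTower.ofTerms L (T K) k).E z old φ X - (GenTower.ofTerms L (fun k Z s (_ : ℂ) old φ => T₀ K k Z s old φ) k).E 0 old φ X‖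
        ≤ 2 * (Real.exp 1 * 9 * 64 * K₀ 64 8 ^ 2 * (2 * (c.C3act * c.ε₁)) * Real.exp (-(r₁ * (domSys (F.P K) M (k + 1)).dj X))) *
            (Cq * ‖z‖ ^ 2) := h
      _ ≤ 2 * (Real.exp 1 * 9 * 64 * K₀ 64 8 ^ 2 * (2 * (c.C3act * c.ε₁)) * Real.exp (-(r₁ * (domSys (F.P K) M (k + 1)).dj X))) *
            (Cq * ((1 + cS) ^ 2 * s ^ 2)) := by
          exact mul_le_mul_of_nonneg_left (mul_le_mul_of_nonneg_left hz2 hCq) (by positivity)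
      _ = 2 * (Real.exp 1 * 9 * 64 * K₀ 64 8 ^ 2 * (2 * (c.C3act * c.ε₁))) * Cq * (1 + cS) ^ 2 *
            Real.exp (-(r₁ * (domSys (F.P K) M (k + 1)).dj X)) * s ^ 2 := by ring

end OfTerms

/-! ## §3 ★★★ At def-W1's (2.14) TERM DATA `(𝔇 K).Gn` — the N22 binders `hholS`, `hbdS` of ROAD 2 from per-term coupling letters of `(𝔇 K k).TF` -/
section TermData

variable (F : T4Family) {M : ℕ} [NeZero M] (L : ℕ) [NeZero L] {𝔸 : Type} {c₀ : B13.Consts} (𝔇 : (K : ℕ) → TermData214 c₀ (F.P K) 𝔸 M L)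
  (T₀ : (K k : ℕ) → (domSys (F.P K) M (k + 1)).Dom → TermLabel (F.P K) M k L → OlderTerms (F.P K) 𝔸 M k → CPair (F.P K) 𝔸 → ℂ)
  (spX : (K k : ℕ) → (domSys (F.P K) M (k + 1)).Dom → Set (CPair (F.P K) 𝔸)) (Adm : (K k : ℕ) → OlderTerms (F.P K) 𝔸 M k → Prop)
  (O : ℕ → Set ℂ)

open Classical in
/-- ★★★ **THE N22 LAST-COUPLING SECTOR BINDERS `hholS`, `hbdS` FOR def-W1's TERM-DATA GENERATORS `(𝔇 K).Gn` FROM PER-TERM COUPLING LETTERS** — §2 at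
`T K := (𝔇 K).TF` (`(𝔇 K).Gn = GenTower.ofTerms L (𝔇 K).TF`, def-W1 `Gn_apply`): (TS-holo) ∕ (TS-226) ∕ (TS-226₀) ∕ (TS-centred) for `z ↦ (𝔇 K k).TF Z s z old φ` against a
z-free centre `T₀` on the class `Adm K k` (the consumer's `old ∈ AdmHist (sp K) E₀ r₁ k ∧ old 0 = 0`) and table `spX K k X` (the consumer's `sp K (k+1) X`), the numerals,
the sector discs inside `O K` ⟹ (hholS) ∧ (2.41 on `O K`) ∧ (hbdS) with `V K k old φ X := (GenTower.ofTerms L (centre terms) k).E 0 old φ X`,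
`B_q := 2·(e·9·64·K₀(64,8)²·(2C₃ε₁))·C_q·(1+c_S)²`, `κ_E := r₁`. [folklore] -/
theorem lastCouplingSectors_termData_of_termSectors (c : B13.Consts) (hL : 8 ≤ c.L) (hLc : c.L = L) {ar a₂ a₂' a₅ Aabs : ℝ}
    (hN : Lemma3Numerics c M ((c.L : ℝ) / 2) ar a₂ a₂' a₅ Aabs) (hA0 : 0 ≤ c.C3act * c.ε₁) {γ r₁ Cq cS : ℝ} (hr₁ : 0 ≤ r₁) (hCq : 0 ≤ Cq)
    (hrate : r₁ + 2 * (64 * Real.log 162) + 2 ≤ (1 - 8 * c.δ) * ((c.L : ℝ) / 2) * c.κ)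
    (hsmall2 : 2 * (c.C3act * c.ε₁) * Real.exp (5 * r₁ + 1) * K₀ 64 8 * 9 * 64 ≤ 1)
    (hO : ∀ K, IsOpen (O K)) (hballS : ∀ K, ∀ s ∈ Ioc (0 : ℝ) γ, closedBall (s : ℂ) (cS * s) ⊆ O K)
    (hTh : ∀ (K k : ℕ) (old : OlderTerms (F.P K) 𝔸 M k), Adm K k old → ∀ (X : (domSys (F.P K) M (k + 1)).Dom), ∀ φ ∈ spX K k X,
      ∀ Z : (domSys (F.P K) M (k + 1)).Dom, Subtype.val Z ⊆ Subtype.val X → ∀ s ∈ terms L M Z,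
        DifferentiableOn ℂ (fun z => (𝔇 K k).TF Z s z old φ) (O K))
    (hT226 : ∀ (K k : ℕ) (old : OlderTerms (F.P K) 𝔸 M k), Adm K k old → ∀ (X : (domSys (F.P K) M (k + 1)).Dom), ∀ φ ∈ spX K k X,
      ∀ Z : (domSys (F.P K) M (k + 1)).Dom, Subtype.val Z ⊆ Subtype.val X → ∀ s ∈ terms L M Z, ∀ z ∈ O K,
        ‖(𝔇 K k).TF Z s z old φ‖ ≤ weight L M c Z ar s * Real.exp (a₅ * ((Z.1).card : ℝ)))
    (hT₀ : ∀ (K k : ℕ) (old : OlderTerms (F.P K) 𝔸 M k), Adm K k old → ∀ (X : (domSys (F.P K) M (k + 1)).Dom), ∀ φ ∈ spX K k X,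
      ∀ Z : (domSys (F.P K) M (k + 1)).Dom, Subtype.val Z ⊆ Subtype.val X → ∀ s ∈ terms L M Z,
        ‖T₀ K k Z s old φ‖ ≤ weight L M c Z ar s * Real.exp (a₅ * ((Z.1).card : ℝ)))
    (hTq : ∀ (K k : ℕ) (old : OlderTerms (F.P K) 𝔸 M k), Adm K k old → ∀ (X : (domSys (F.P K) M (k + 1)).Dom), ∀ φ ∈ spX K k X,
      ∀ Z : (domSys (F.P K) M (k + 1)).Dom, Subtype.val Z ⊆ Subtype.val X → ∀ s ∈ terms L M Z, ∀ z ∈ O K,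
        ‖(𝔇 K k).TF Z s z old φ - T₀ K k Z s old φ‖ ≤ Cq * ‖z‖ ^ 2 * (weight L M c Z ar s * Real.exp (a₅ * ((Z.1).card : ℝ)))) :
    (∀ (K k : ℕ) (old : OlderTerms (F.P K) 𝔸 M k), Adm K k old → ∀ (X : (domSys (F.P K) M (k + 1)).Dom), ∀ φ ∈ spX K k X,
      DifferentiableOn ℂ (fun z => ((𝔇 K).Gn k).E z old φ X) (O K)) ∧
    (∀ (K k : ℕ) (old : OlderTerms (F.P K) 𝔸 M k), Adm K k old → ∀ (X : (domSys (F.P K) M (k + 1)).Dom), ∀ φ ∈ spX K k X, ∀ z ∈ O K,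
      ‖((𝔇 K).Gn k).E z old φ X‖ ≤
        Real.exp 1 * 9 * 64 * K₀ 64 8 ^ 2 * (c.C3act * c.ε₁) * Real.exp (-(r₁ * (domSys (F.P K) M (k + 1)).dj X))) ∧
    (∀ (K k : ℕ) (old : OlderTerms (F.P K) 𝔸 M k), Adm K k old → ∀ (X : (domSys (F.P K) M (k + 1)).Dom), ∀ φ ∈ spX K k X,
      ∀ s ∈ Ioc (0 : ℝ) γ, ∀ z ∈ closedBall (s : ℂ) (cS * s),
        ‖((𝔇 K).Gn k).E z old φ X -
            (GenTower.ofTerms L (fun k Z s (_ : ℂ) old φ => T₀ K k Z s old φ) k).E 0 old φ X‖ ≤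
          2 * (Real.exp 1 * 9 * 64 * K₀ 64 8 ^ 2 * (2 * (c.C3act * c.ε₁))) * Cq * (1 + cS) ^ 2 *
            Real.exp (-(r₁ * (domSys (F.P K) M (k + 1)).dj X)) * s ^ 2) :=
  lastCouplingSectors_ofTerms_of_termSectors F L (fun K => (𝔇 K).TF) T₀ spX Adm O c hL hLc hN hA0 hr₁ hCq hrate hsmall2 hO hballS
    hTh hT226 hT₀ hTq

end TermData

end YMDAG.N10

end
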